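import Mathlib
import Summits.Langlands.Langlands.Theses.PicardMuOrdinary
import Literature.NumberTheory.GaloisRepresentations.GaloisRep
import Literature.NumberTheory.GaloisRepresentations.OrdinaryRegular
import Literature.NumberTheory.GaloisRepresentations.LocalClassFieldTheory

/-!
# drefute g3 — a TYPED Galois-side replacement for the empty guard `HasMuOrdinaryReductionAtThree f`

For the lead / tenure planner of crux stmt-Langlands-13758 (line `split-ramified-prime-sqrt6`).
The typed guard of Stubs 3/5/7 is empty on `ℤ[X]` (BBW 2017 Lemma 4; drefute g1/g2, cdisprove item 24).
The engine of Stub 5 (μ-ordinary higher Hida theory + two-wall Sen = Cousin) only ever uses the LOCAL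
GALOIS shape of `ρ'_C = ρ_C ⊗ ψ` at `λ`: a `Γ_{K_λ}`-stable full flag (multiplicative ⊂ connected ⊂ all,
from the 3-divisible group of the Néron model over the potentially-good-reduction field `M_w`, which is
`Γ_{K_λ}`-stable because the connected and multiplicative parts are canonical) whose diagonal characters
are, on the open subgroup `I_{M_w}` of inertia, the algebraic characters of labelled Hodge–Tate type
`A` at the `e`-label and `B` at the conjugate label (for `ρ'_C`: `{2,1,1} | {1,1,0}` in flag order, up
to the tree's sign convention `HT(ε) = -1` — the planner fixes `A, B`).  This is EXACTLY the tree's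
accepted `FramedGaloisRep.IsOrdinaryOfLabelledWeightAt` (OrdinaryRegular.lean: Geraghty/Qian
"ordinary of weight λ" WITHOUT the dominance/regularity clause — repeated weights allowed), relative to a
local Artin datum `art` (a parameter, as everywhere in the tree).

So the guard below ELABORATES TODAY, is a predicate on Stub 2's output `ρ` (case split after Stubs
1–2, composition `Probes.composition_of_galois_split`), is satisfied on paper by every `f` of BBW stable
type (b) (e.g. `f = 3x⁴ + x³ - 54`, `Gal = S₄`, cdisprove item 25) and fails for type (a) (curve
potentially good ⇒ `J` supersingular, no unit-root line) — i.e. it is the honest "`ρ_C` μ-ordinary at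
`λ`" the remainder stub should negate.
-/

open Literature.NumberTheory.GaloisRepresentations
open IsDedekindDomain NumberField Polynomial

noncomputable section

namespace Summit.Langlands.Langlands.Cruxes.IrregularClassicality.DrefuteG3.RepairGuard

local notation "K" => CyclotomicField 3 ℚ

/-- The labelled weight at a place `v` of `K`: type `A` at the label `τ : K_v → ℚ̄₃` whose restriction
to `K` is `ι⁻¹ ∘ e` (the `e`-label), type `B` at the other label. -/
def labelWeight (ι : PadicAlgCl 3 ≃+* ℂ) (e : K →+* ℂ) (v : HeightOneSpectrum (𝓞 K))
    (A B : Fin 3 → ℤ) : LabelledWeight (v.adicCompletion K) (PadicAlgCl 3) 3 :=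
  fun τ => by
    classical
    exact if ∀ x : K, τ (algebraMap K (v.adicCompletion K) x) = ι.symm (e x) then A else B

/-- **The Galois-side μ-ordinarity guard** (typed replacement for `HasMuOrdinaryReductionAtThree f`):
at the (unique) place `v ∣ 3` of `K`, `ρ|_{Γ_{K_v}}` is ordinary of the labelled weight
`labelWeight ι e v A B` relative to the Artin datum `art v` — upper triangular in some frame, with
diagonal characters equal to the prescribed algebraic characters on an open subgroup of inertia
(`FramedGaloisRep.IsOrdinaryOfLabelledWeightAt`, no regularity required). -/
def MuOrdinaryGaloisGuard (art : ∀ v : HeightOneSpectrum (𝓞 K), LocalArtinData (v.adicCompletion K))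
    (A B : Fin 3 → ℤ) (_f : ℤ[X]) (ι : PadicAlgCl 3 ≃+* ℂ) (e : K →+* ℂ)
    (ρ : FramedGaloisRep K (PadicAlgCl 3) 3) : Prop :=
  ∃ v : HeightOneSpectrum (𝓞 K), ((3 : ℕ) : 𝓞 K) ∈ v.asIdeal ∧
    ρ.IsOrdinaryOfLabelledWeightAt v (art v) (labelWeight ι e v A B)

/-- Unfolding, in the tree's own vocabulary (frame `g`, open subgroup `U`, Weil inertia). -/
theorem muOrdinaryGaloisGuard_iff
    (art : ∀ v : HeightOneSpectrum (𝓞 K), LocalArtinData (v.adicCompletion K))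
    (A B : Fin 3 → ℤ) (f : ℤ[X]) (ι : PadicAlgCl 3 ≃+* ℂ) (e : K →+* ℂ)
    (ρ : FramedGaloisRep K (PadicAlgCl 3) 3) :
    MuOrdinaryGaloisGuard art A B f ι e ρ ↔
    ∃ v : HeightOneSpectrum (𝓞 K), ((3 : ℕ) : 𝓞 K) ∈ v.asIdeal ∧
      ∃ g : GL (Fin 3) (PadicAlgCl 3), FramedRep.IsUpperTriangular ((ρ.toLocal v).conj g) ∧
        ∃ U : OpenSubgroup (Field.absoluteGaloisGroup (v.adicCompletion K)),
          ∀ w ∈ WeilGroup.inertia (v.adicCompletion K),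
            WeilGroup.toAbsGalois (v.adicCompletion K) w ∈ U → ∀ i : Fin 3,
              FramedRep.diagEntry ((ρ.toLocal v).conj g) i (WeilGroup.toAbsGalois _ w) =
                (ordinaryWeightUnit (labelWeight ι e v A B) i ((art v).artin w) : PadicAlgCl 3) :=
  Iff.rfl

/-- The repaired guard for Stub 5 in the shape of `Probes.GaloisGuard`
(`ℤ[X] → (ℚ̄₃ ≃+* ℂ) → (K →+* ℂ) → FramedGaloisRep K ℚ̄₃ 3 → Prop`). -/
example (art : ∀ v : HeightOneSpectrum (𝓞 K), LocalArtinData (v.adicCompletion K))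
    (A B : Fin 3 → ℤ) :
    ℤ[X] → (PadicAlgCl 3 ≃+* ℂ) → (K →+* ℂ) → FramedGaloisRep K (PadicAlgCl 3) 3 → Prop :=
  MuOrdinaryGaloisGuard art A B

end Summit.Langlands.Langlands.Cruxes.IrregularClassicality.DrefuteG3.RepairGuard

end
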